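import Literature.AlgebraicTopology.SingularHomology.FiltrationExactCouple
import Literature.AlgebraicTopology.SingularHomology.RelativeCapProduct
import Literature.Algebra.Homology.ExactCoupleLefschetz
import HarnessLib

/-!
# The cap product with a degree-two class is a Lefschetz endomorphism of the exact couple of a filtration

Topic `Literature/AlgebraicTopology/SingularHomology`, sibling of `FiltrationExactCouple.lean` (the
homology exact couple of an increasing filtration `X₀ ⊆ X₁ ⊆ ⋯` of a space `X`, Spanier 1981,
Ch. 9, Sec. 1, Ex. 5–6) and of `Literature/Algebra/Homology/ExactCoupleLefschetz.lean` (Deligne's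
degeneration criterion for a couple carrying a degree-`(0,-2)` endomorphism with hard Lefschetz on
`E¹`). For a class `η ∈ H²(X; K)` the cap products with the restrictions `η|_{X_s}`,

  `η|_{X_s} ⌢ · : H_{q+2}(X_s; K) → H_q(X_s; K)`,  `η|_{X_s} ⌢ · : H_{q+2}(X_s, X_{s-1}; K) → H_q(X_s, X_{s-1}; K)`,

commute with the three maps of the couple — the maps induced by the inclusions (projection
formula, Hatcher 2002, §3.3 p. 241), `j_*` (`relCapProduct_ofAbsolute`) and the connecting maps
(the boundary formula `∂(a ⌢ z) = (-1)ᵖ (i^*a) ⌢ ∂z`, `δ_relCapProduct`, with `p = 2`) — so they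
form a `HomologyExactCouple.LefschetzEndo` (`Filtration.capEndo`). This is the topological content
of C. Voisin, *Hodge Theory and Complex Algebraic Geometry II* (2003), Lemma 4.13 ("the morphism
`L = [ω] ∪ ·` … is compatible with the differentials of the Leray spectral sequence"), in the
homological, cap-product form used by the tree. Consequence (`ker_map_eq_ker_map_of_eHardLefschetz`):
if the cap product satisfies hard Lefschetz on `E¹ = ⊕ H_•(X_s, X_{s-1})` (centred at fibre degree
`n₀`) and `H_q(X_s, X_{s-1}) = 0` unless `s ≤ q ≤ s + 2n₀`, then a class of `H_q(X₀)` dies in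
`H_q(X)` iff it dies in `H_q(X₁)` — the edge statement of Deligne's degeneration theorem
(Voisin II, Thm. 4.15 / Thm. 4.18) for filtered spaces. Everything is proved; no named fact.

## References

* C. Voisin, *Hodge Theory and Complex Algebraic Geometry II*, CUP (2003), Lemma 4.13, Thm. 4.15,
  Thm. 4.18. [VoisinHodgeII2003]
* A. Hatcher, *Algebraic Topology*, CUP (2002), §3.3 pp. 239–241. [HatcherAT2002]
* E. H. Spanier, *Algebraic Topology*, Springer (1981), Ch. 9, Sec. 1, Ex. 5–6. [Spanier1981]
-/

noncomputable section

open CategoryTheory Set Function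
open Literature.Algebra.Homology

universe u v

namespace Literature.AlgebraicTopology.SingularHomology

variable (K : Type v) [Field K] {X : Type u} [TopologicalSpace X] (F : ℕ → Set X) (hF : Monotone F)
  (η : singularCohomology K K X 2)

namespace Filtration

/-- The restriction `η|_{X_s} ∈ H²(X_s; K)`. [folklore] -/
abbrev restrictClass (s : ℕ) : singularCohomology K K ↥(F s) 2 :=
  singularCohomology.map K K (subsetIncl (F s)) 2 η

/-- Restricting `η|_{X_{s'}}` further to `X_s ⊆ X_{s'}` gives `η|_{X_s}`. [folklore] -/
theorem map_subsetInclusion_restrictClass {s s' : ℕ} (h : F s ⊆ F s') :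
    singularCohomology.map K K (subsetInclusion h) 2 (restrictClass K F η s') =
      restrictClass K F η s := by
  change (singularCohomology.map K K (subsetIncl (F s')) 2 ≫
    singularCohomology.map K K (subsetInclusion h) 2) η = _
  rw [← singularCohomology.map_comp]
  rfl

/-- On the copy `X_{s+1} ↓∩ X_s` of `X_s` inside `X_{s+1}`, the restriction of `η|_{X_{s+1}}` is the
pull-back of `η|_{X_s}` along the tautological map `shrink`. [folklore] -/
theorem map_val_restrictClass (s : ℕ) :
    singularCohomology.map K K (⟨Subtype.val, continuous_subtype_val⟩ :
        C(↥(Subtype.val ⁻¹' F s : Set ↥(F (s + 1))), ↥(F (s + 1)))) 2 (restrictClass K F η (s + 1)) =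
      singularCohomology.map K K (shrink F s) 2 (restrictClass K F η s) := by
  change (singularCohomology.map K K (subsetIncl (F (s + 1))) 2 ≫ singularCohomology.map K K _ 2) η =
    (singularCohomology.map K K (subsetIncl (F s)) 2 ≫ singularCohomology.map K K (shrink F s) 2) η
  rw [← singularCohomology.map_comp, ← singularCohomology.map_comp]
  rfl

/-- **`L = η|_{X_s} ⌢ ·` on `H_•(X_s; K)`**. [cite: VoisinHodgeII2003, Lemma 4.13] -/
def capA (s q : ℕ) : singularHomology K K ↥(F s) (q + 2) →ₗ[K] singularHomology K K ↥(F s) q :=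
  capProduct (show 2 + q = q + 2 by omega) (restrictClass K F η s)

/-- **`L = η|_{X_s} ⌢ ·` on `E_s = H_•(X_s, X_{s-1}; K)`** (`E₀ = H_•(X₀)`). [cite: VoisinHodgeII2003, Lemma 4.13] -/
def capE : (s q : ℕ) → (E K F s (q + 2) →ₗ[K] E K F s q)
  | 0, q => capA K F η 0 q
  | s + 1, q => relCapProduct (Subtype.val ⁻¹' F s) (show 2 + q = q + 2 by omega)
      (restrictClass K F η (s + 1))

/-- `capE` in positive filtration is the relative cap product. [folklore] -/
theorem capE_succ (s q : ℕ) (x : E K F (s + 1) (q + 2)) :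
    capE K F η (s + 1) q x = relCapProduct (Subtype.val ⁻¹' F s) (show 2 + q = q + 2 by omega)
      (restrictClass K F η (s + 1)) x := rfl

variable (hcpt : ∀ C : Set X, IsCompact C → ∃ s, C ⊆ F s)

/-- **The cap product with `η` is a Lefschetz endomorphism of the exact couple of the filtration**
(it commutes with the maps induced by inclusions — projection formula —, with `j_*`, and with the
connecting maps — boundary formula with the sign `(-1)² = 1`): Voisin II, Lemma 4.13 in
homological form. [cite: VoisinHodgeII2003, Lemma 4.13] -/
def capEndo : (filtrationCouple K F hF hcpt).LefschetzEndo where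
  LA := capA K F η
  LE := capE K F η
  comm_ι q s s' h a := by
    change capProduct _ (restrictClass K F η s')
        (singularHomology.map K K (subsetInclusion (hF h)) (q + 2) a) =
      singularHomology.map K K (subsetInclusion (hF h)) q (capProduct _ (restrictClass K F η s) a)
    rw [← capProduct_map, map_subsetInclusion_restrictClass]
  comm_j s q a := by
    cases s with
    | zero => rfl
    | succ s =>
      change relCapProduct (Subtype.val ⁻¹' F s) _ (restrictClass K F η (s + 1))
          (relativeSingularHomology.ofAbsolute K K ↥(F (s + 1)) (Subtype.val ⁻¹' F s) (q + 2) a) =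
        relativeSingularHomology.ofAbsolute K K ↥(F (s + 1)) (Subtype.val ⁻¹' F s) q
          (capProduct _ (restrictClass K F η (s + 1)) a)
      exact relCapProduct_ofAbsolute (Subtype.val ⁻¹' F s) _ (restrictClass K F η (s + 1)) a
  comm_δ s q x := by
    change capProduct _ (restrictClass K F η s) (singularHomology.map K K (shrink F s) (q + 2)
        (relativeSingularHomology.δ K K ↥(F (s + 1)) (Subtype.val ⁻¹' F s) (q + 2) x)) =
      singularHomology.map K K (shrink F s) q
        (relativeSingularHomology.δ K K ↥(F (s + 1)) (Subtype.val ⁻¹' F s) q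
          (relCapProduct (Subtype.val ⁻¹' F s) _ (restrictClass K F η (s + 1)) x))
    rw [δ_relCapProduct (Subtype.val ⁻¹' F s) (show 2 + q = q + 2 by omega)
      (restrictClass K F η (s + 1)) x]
    rw [show ((-1 : K) ^ 2) = 1 by norm_num, one_smul, map_val_restrictClass, capProduct_map]

/-- `capEndo` acts on `E_{s+1}` by the relative cap product. [folklore] -/
theorem capEndo_LE_succ (s q : ℕ) (x : E K F (s + 1) (q + 2)) :
    (capEndo K F hF η hcpt).LE (s + 1) q x =
      relCapProduct (Subtype.val ⁻¹' F s) (show 2 + q = q + 2 by omega)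
        (restrictClass K F η (s + 1)) x := rfl

/-- `capEndo` acts on `E₀ = H_•(X₀)` by the absolute cap product. [folklore] -/
theorem capEndo_LE_zero (q : ℕ) (x : E K F 0 (q + 2)) :
    (capEndo K F hF η hcpt).LE 0 q x =
      capProduct (show 2 + q = q + 2 by omega) (restrictClass K F η 0) x := rfl

/-- **Deligne's edge theorem for a filtered space** (Voisin II, Thm. 4.15 with Thm. 4.18, in
homology): if the cap product with `η` satisfies hard Lefschetz on
`E¹ = ⊕_s H_•(X_s, X_{s-1}; K)` centred at fibre degree `n₀`, and `H_q(X_s, X_{s-1}; K) = 0`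
unless `s ≤ q ≤ s + 2n₀`, then a class of `H_q(X₀; K)` vanishes in `H_q(X; K)` iff it vanishes in
`H_q(X₁; K)`. [cite: VoisinHodgeII2003, Thm. 4.15 and Thm. 4.18] -/
theorem ker_map_eq_ker_map_of_eHardLefschetz {n₀ : ℕ}
    (hL : (capEndo K F hF η hcpt).EHardLefschetz n₀)
    (hlo : ∀ s q, q < s → ∀ x : E K F s q, x = 0)
    (hhi : ∀ s q, s + 2 * n₀ < q → ∀ x : E K F s q, x = 0) (q : ℕ) :
    LinearMap.ker (singularHomology.map K K (subsetIncl (F 0)) q).hom =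
      LinearMap.ker (singularHomology.map K K
        (subsetInclusion (hF (Nat.le_add_right 0 1)) : C(↥(F 0), ↥(F (0 + 1)))) q).hom :=
  (capEndo K F hF η hcpt).Kinf_zero_eq_Kr_one_of_eHardLefschetz hlo hhi hL q

end Filtration

end Literature.AlgebraicTopology.SingularHomology
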